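import Literature.Probability.Percolation.TriMarkedDomainOfDarts
import Literature.Probability.Percolation.MarkedLoopArcPointOfDart
import Literature.Probability.Percolation.TriOneBlock
import HarnessLib

/-!
# Ring-pattern criteria: which boundary darts are markable, which are flat («RING-LOCAL»)

Topic `Literature/Probability/Percolation`; family `crit-perc` / marked-loop lineage; a rider on `TriMarkedDomainOfDarts.lean` («TRI-MARK-DARTS»: `IsMarkable G d` — the
`triBdrySucc`-predecessor of `d` has the same tail, its pre-predecessor a different one; ★★★ `TriMarkedDomain.ofDarts`) and `MarkedLoopArcPointOfDart.lean` («ARC-POINT-OF-DART»: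
★★★ `ArcPoint.ofFlatDart` from a dart of an arc both of whose apices lie in `G`).

Both hypotheses are discharged here from the RING PATTERN of `G` at the tail `g` alone (directions `triDir j`, `j : Fin 6`, anticlockwise; `triLeftApex_add_triDir`,
`triLeftApex_add_triDir_left`, `triBdrySucc_into`), so that the sandpile class of HOME `FINDING-BSPAN-SLIDE-INDUCTION.md` (G0) — or any family given by coordinates — can be
marked and observed without computing its boundary walk:

* `triBdrySucc_turn` — if `g + e_j ∉ G` and `g + e_{j+1} ∉ G`, the boundary walk turns about `g`: `triBdrySucc G (g, g + e_j) = (g, g + e_{j+1})`;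
* `triBdrySucc_step_in` — if `g + e_{j+5} ∈ G` and `g + e_j ∉ G`, the walk arrives at `(g, g + e_j)` from `(g + e_{j+5}, g + e_j)`;
* ★★ `isMarkable_of_ring` — **`g ∈ G`, `g + e_{j+5} ∈ G`, `g + e_j ∉ G`, `g + e_{j+1} ∉ G` ⇒ the dart `(g, g + e_{j+1})` is MARKABLE** (Bollobás–Riordan: `g + e_{j+1}` is the second
  outside neighbour of `g` met by the anticlockwise walk, the first being `g + e_j`, entered from the inside neighbour `g + e_{j−1}`);
* ★ `ArcPoint.ofRing` — **`(g, g + e_j) ∈ A_a`, `g + e_{j+1} ∈ G`, `g + e_{j+5} ∈ G` ⇒ a boundary mid-edge on `A_a`** (the dart is flat: `triLeftApex g (g+e_j) = g + e_{j+1}`,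
  `triLeftApex (g+e_j) g = g + e_{j+5}`).

## References
* B. Bollobás, O. Riordan, *Percolation*, CUP (2006), Ch. 7 §7.2.2 pp. 168–169 (the anticlockwise boundary walk; marked sites and their second outside neighbour).
* M. Khristoforov, S. Smirnov, *Percolation and O(1) loop model*, arXiv:2111.15612 (2021), §2 eq. (4) and Remark 6 (arXiv v1 p. 5: `z` on a boundary arc).

## Mathlib / tree
Tree: `TriMarkedDomainOfDarts` (`IsMarkable`), `MarkedLoopArcPointOfDart` (`ArcPoint.ofFlatDart`), `TriDiscShelling` (`triDir`, `triDir_add_triDir_add_two`, `triDir_add_three`,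
`triLeftApex_add_triDir`, `triLeftApex_add_triDir_left`, `triGraph_adj_add_triDir`, `add_triDir_ne`), `TriOneBlock` (`triBdrySucc_into`), `TriDiscreteDomain` (`triBdrySucc`,
`mem_triBdryDarts`).
-/

noncomputable section

open Finset Literature.Probability.LatticeModels

namespace Literature.Probability.Percolation

/-! ### The boundary successor in ring coordinates -/

/-- Auxiliary `Fin 6` arithmetic. [cite: BollobasRiordan2006, Ch. 7 §7.2.2 p. 168 (the boundary walk); lane plumbing] -/
private theorem fin6_facts (j : Fin 6) : j + 4 + 5 = j + 3 ∧ j + 4 + 2 = j ∧ j + 4 + 1 = j + 5 ∧ j + 5 + 2 = j + 1 ∧ j + 5 + 1 = j := by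
  revert j; decide

/-- `g + e_j + e_{j+4} = g + e_{j+5}` (two sides of a lattice triangle). [cite: BollobasRiordan2006, Ch. 7 §7.2.2 p. 168; lane plumbing] -/
theorem add_triDir_add_triDir_add_four (g : Site 2) (j : Fin 6) : g + triDir j + triDir (j + 4) = g + triDir (j + 5) := by
  have h := triDir_add_triDir_add_two (j + 4)
  rw [(fin6_facts j).2.1, (fin6_facts j).2.2.1, add_comm (triDir (j + 4))] at h
  rw [add_assoc, h]

/-- **the walk TURNS about `g`**: if `g + e_j ∉ G` and `g + e_{j+1} ∉ G` then `triBdrySucc G (g, g + e_j) = (g, g + e_{j+1})`.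
[cite: BollobasRiordan2006, Ch. 7 §7.2.2 p. 168 (the anticlockwise boundary walk)] -/
theorem triBdrySucc_turn {G : Finset (Site 2)} {g : Site 2} (j : Fin 6) (h1 : g + triDir (j + 1) ∉ G) :
    triBdrySucc G (g, g + triDir j) = (g, g + triDir (j + 1)) := by
  simp only [triBdrySucc, triLeftApex_add_triDir, if_neg h1]

/-- **the walk STEPS IN to `g`**: if `g + e_{j+5} ∈ G` then `triBdrySucc G (g + e_{j+5}, g + e_j) = (g, g + e_j)` (the face left of the dart `g + e_{j+5} → g + e_j` has apex `g`).
[cite: BollobasRiordan2006, Ch. 7 §7.2.2 p. 168 (the anticlockwise boundary walk)] -/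
theorem triBdrySucc_step_in {G : Finset (Site 2)} {g : Site 2} (j : Fin 6) (hg : g ∈ G) :
    triBdrySucc G (g + triDir (j + 5), g + triDir j) = (g, g + triDir j) := by
  -- write the dart as `(w + e_{j+4}, w)` with `w = g + e_j`; then `w + e_{j+4+5} = w + e_{j+3} = g`
  have hw : g + triDir j + triDir (j + 4 + 5) = g := by
    rw [(fin6_facts j).1, triDir_add_three, add_neg_cancel_right]
  have h := triBdrySucc_into (G := G) (w := g + triDir j) (j + 4) (by rw [hw]; exact hg)
  rw [add_triDir_add_triDir_add_four, hw] at h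
  exact h

/-! ### Markable darts from the ring pattern -/

/-- ★★ **MARKABILITY FROM THE RING PATTERN AT THE TAIL**: if `g ∈ G`, its neighbour in direction `j + 5 = j − 1` is in `G` and its neighbours in directions `j`, `j + 1` are not, then the
boundary dart `(g, g + e_{j+1})` — pointing to the SECOND outside neighbour of this outside run, the walk having entered `g` from `g + e_{j−1}` and turned once — is markable.
[cite: BollobasRiordan2006, Ch. 7 §7.2.2 p. 169 (marked sites «adjacent to at least two sites of `T ∖ G`», marked at the second outside neighbour)] -/
theorem isMarkable_of_ring {G : Finset (Site 2)} {g : Site 2} (j : Fin 6) (hg : g ∈ G) (hprev : g + triDir (j + 5) ∈ G)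
    (h0 : g + triDir j ∉ G) (h1 : g + triDir (j + 1) ∉ G) : IsMarkable G (g, g + triDir (j + 1)) := by
  have hd : (g, g + triDir (j + 1)) ∈ triBdryDarts G := mem_triBdryDarts.2 ⟨hg, h1, triGraph_adj_add_triDir g (j + 1)⟩
  have hd₁ : (g, g + triDir j) ∈ triBdryDarts G := mem_triBdryDarts.2 ⟨hg, h0, triGraph_adj_add_triDir g j⟩
  have hadj₂ : triGraph.Adj (g + triDir (j + 5)) (g + triDir j) := by
    have := triGraph_adj_consec g (j + 5)
    rwa [(fin6_facts j).2.2.2.2] at this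
  have hd₂ : (g + triDir (j + 5), g + triDir j) ∈ triBdryDarts G := mem_triBdryDarts.2 ⟨hprev, h0, hadj₂⟩
  exact ⟨hd, (g, g + triDir j), hd₁, triBdrySucc_turn j h1, rfl, (g + triDir (j + 5), g + triDir j), hd₂, triBdrySucc_step_in j hg,
    add_triDir_ne g (j + 5)⟩

/-! ### Flat darts and boundary mid-edges from the ring pattern -/

namespace MarkedLoops

open TriMarkedDomain

/-- ★ **A BOUNDARY MID-EDGE FROM THE RING PATTERN**: a dart `(g, g + e_j)` of the stretch `A_a` whose two neighbouring directions `j + 1`, `j + 5` at `g` are sites of `G` is flat,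
hence carries an `ArcPoint D a` (read at the face left of the dart). [cite: KhristoforovSmirnov2021, §2 eq. (4) and Remark 6 (arXiv v1 p. 5); BollobasRiordan2006, Ch. 7 §7.2.2 pp. 191–195] -/
def ArcPoint.ofRing {nm : ℕ} {D : TriMarkedDomain nm} {a : Fin nm} {g : Site 2} (j : Fin 6) (hd : (g, g + triDir j) ∈ D.stretch a)
    (hnext : g + triDir (j + 1) ∈ D.verts) (hprev : g + triDir (j + 5) ∈ D.verts) : ArcPoint D a :=
  ArcPoint.ofFlatDart hd (by rw [triLeftApex_add_triDir]; exact hnext) (by rw [triLeftApex_add_triDir_left]; exact hprev)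

/-- its face. [cite: KhristoforovSmirnov2021, §2 eq. (4) (arXiv v1 p. 5)] -/
@[simp] theorem ArcPoint.ofRing_v {nm : ℕ} {D : TriMarkedDomain nm} {a : Fin nm} {g : Site 2} (j : Fin 6) (hd : (g, g + triDir j) ∈ D.stretch a)
    (hnext : g + triDir (j + 1) ∈ D.verts) (hprev : g + triDir (j + 5) ∈ D.verts) : (ArcPoint.ofRing j hd hnext hprev).v = leftFace g (g + triDir j) := rfl

/-- its dart. [cite: KhristoforovSmirnov2021, §2 eq. (4) (arXiv v1 p. 5)] -/
theorem ArcPoint.ofRing_dart {nm : ℕ} {D : TriMarkedDomain nm} {a : Fin nm} {g : Site 2} (j : Fin 6) (hd : (g, g + triDir j) ∈ D.stretch a)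
    (hnext : g + triDir (j + 1) ∈ D.verts) (hprev : g + triDir (j + 5) ∈ D.verts) :
    (ArcPoint.ofRing j hd hnext hprev).g = g ∧ (ArcPoint.ofRing j hd hnext hprev).o = g + triDir j := ⟨rfl, rfl⟩

end MarkedLoops

end Literature.Probability.Percolation
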